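import Mathlib
import Summits.NavierStokesRegularity.NavierStokesRegularity.Theorems.FrozenSignCascadeTightEnvelopeContinuationRadial
import HarnessLib

/-!
# Route FrozenSignCascade · item `TightEnvelopeContinuation` — helper 2: the convolution at a
  high frequency under a tight critical envelope

Helper file for statement item stmt-NavierStokesRegularity-10580 (`TightEnvelopeContinuation`,
support of route `FrozenSignCascade`); lands `--supports` that item.

This file is the heart of the a-priori bound of the next helper (`…APriori`,
`hasDecay_four_of_tight`): the estimate of the convolution `(v_j ⋆ v_k)(ξ)` at a **high**
frequency `‖ξ‖ ≥ 2R` for a coefficient field `v : ℝ³ → ℂ³` with an order-`4` weight bound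
`‖v(η)‖ ≤ Φ (1+‖η‖)⁻⁴`, a low-frequency bound `‖v(ζ)‖ ≤ M` (`‖ζ‖ < R`) and a **tight critical
envelope** `‖ζ‖² ‖v(ζ)‖ ≤ ε` (`‖ζ‖ ≥ R ≥ 1`):

* `norm_fconv_le_of_tight` —
  `‖(v_j ⋆ v_k)(ξ)‖ ≤ Φ (1+‖ξ‖)⁻⁴ (32 M |B_R| + 96 |B₁| ε ‖ξ‖) + 12 |B₁| Φ ε ‖ξ‖⁻³`.
  The integrand `|v_j(η)| |v_k(ξ-η)|` is symmetrised over `‖ξ‖ ≤ 2‖η‖ ∨ ‖ξ‖ ≤ 2‖ξ-η‖`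
  (`norm_le_two_mul_or`); on `‖ξ‖ ≤ 2‖η‖` the factor at `η` carries `16 Φ (1+‖ξ‖)⁻⁴`
  (`inv_weight_le_sixteen_mul`) and the factor at `ζ = ξ - η` is bounded by `M` on `‖ζ‖ < R`
  (volume `|B_R|`), by `ε ‖ζ‖⁻²` on `R ≤ ‖ζ‖ ≤ ‖ξ‖` (annulus integral `≤ 3|B₁| ‖ξ‖`,
  `integral_annulus_inv_norm_sq_le`), and by `ε ‖ξ‖⁻²` beyond, there against the tail
  `∫_{‖η‖ ≥ ‖ξ‖/2} (1+‖η‖)⁻⁴ ≤ 6|B₁| / ‖ξ‖` (`integral_tail_weight_le`). Every piece is LINEAR in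
  `Φ` with a coefficient that is small (`ε`) or decays in `‖ξ‖` — the scale-critical bookkeeping
  `∫ ‖η‖⁻² ‖ξ-η‖⁻² dη ∼ ‖ξ‖⁻¹` done with elementary integrals.
* `absorb_le_half` — the pure algebra turning this bound, the symbol factor `36π‖ξ‖` and the heat
  integral `(c‖ξ‖²)⁻¹` into `≤ Φ/2` at order `4` when `13824 π ε · 3|B₁| ≤ c` and
  `4608 π M |B_R| ≤ c R₁ ≤ c ‖ξ‖`.

Reference for the weighted (pseudo-measure) calculus: P. G. Lemarié-Rieusset, *The Navier–Stokes
problem in the 21st century* (2016), §8.5 and Thm. 8.21; Y. Le Jan, A.-S. Sznitman, PTRF 109 (1997).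
-/

noncomputable section

set_option linter.dupNamespace false -- nested layout Summit.<S>.<Sub>, Sub = S (D-0017)

open MeasureTheory Set Metric Real Filter
open scoped ENNReal
open Literature.Analysis.FluidPDE.FourierNS

namespace Summit.NavierStokesRegularity.NavierStokesRegularity.Theorems.TightEnvelope

/-! ### The high-frequency convolution bound -/

/-- **The convolution at a high frequency under a tight envelope.** Let `v : ℝ³ → ℂ³` satisfy the
order-`4` weight bound `‖v(η)‖ ≤ Φ (1+‖η‖)⁻⁴`, the low-frequency bound `‖v(ζ)‖ ≤ M` for `‖ζ‖ < R`
and the tight envelope `‖ζ‖² ‖v(ζ)‖ ≤ ε` for `‖ζ‖ ≥ R ≥ 1`. Then at every frequency `‖ξ‖ ≥ 2R`,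
`‖(v_j ⋆ v_k)(ξ)‖ ≤ Φ (1+‖ξ‖)⁻⁴ (32 M |B_R| + 32 ε · 3|B₁| ‖ξ‖) + 4 Φ ε · 3|B₁| ‖ξ‖⁻³`. -/
theorem norm_fconv_le_of_tight {v : EuclideanSpace ℝ (Fin 3) → Fin 3 → ℂ} {Φ M ε R : ℝ}
    {ξ : EuclideanSpace ℝ (Fin 3)} (hΦ : HasDecay 4 Φ v) (hM0 : 0 ≤ M)
    (hM : ∀ ζ, ‖ζ‖ < R → ‖v ζ‖ ≤ M) (hε : 0 ≤ ε)
    (htight : ∀ ζ, R ≤ ‖ζ‖ → ‖ζ‖ ^ 2 * ‖v ζ‖ ≤ ε) (hR : 1 ≤ R) (hξ : 2 * R ≤ ‖ξ‖)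
    (j k : Fin 3) :
    ‖fconv (v · j) (v · k) ξ‖ ≤
      Φ * ((1 + ‖ξ‖) ^ 4)⁻¹ * (32 * M * (volume (ball (0 : EuclideanSpace ℝ (Fin 3)) R)).toReal +
        32 * ε * (3 * (volume (ball (0 : EuclideanSpace ℝ (Fin 3)) 1)).toReal) * ‖ξ‖) +
      4 * Φ * ε * (3 * (volume (ball (0 : EuclideanSpace ℝ (Fin 3)) 1)).toReal) * (‖ξ‖ ^ 3)⁻¹ := by
  have hΦ0 : 0 ≤ Φ := hΦ.nonneg
  have hR0 : 0 < R := by linarith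
  have hξ0 : 0 < ‖ξ‖ := by linarith
  have hξR : R ≤ ‖ξ‖ := by linarith
  set vB : ℝ := (volume (ball (0 : EuclideanSpace ℝ (Fin 3)) R)).toReal with hvB
  set CE : ℝ := 3 * (volume (ball (0 : EuclideanSpace ℝ (Fin 3)) 1)).toReal with hCE
  have hvB0 : 0 ≤ vB := ENNReal.toReal_nonneg
  have hCE0 : 0 ≤ CE := by positivity
  set W : ℝ := ((1 + ‖ξ‖) ^ 4)⁻¹ with hW
  have hW0 : 0 ≤ W := by positivity
  -- the three comparison sets
  set A : Set (EuclideanSpace ℝ (Fin 3)) := {ζ | R ≤ ‖ζ‖ ∧ ‖ζ‖ ≤ ‖ξ‖} with hA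
  set S : Set (EuclideanSpace ℝ (Fin 3)) := {η | ‖ξ‖ / 2 ≤ ‖η‖} with hS
  have hAm : MeasurableSet A :=
    (measurableSet_le measurable_const continuous_norm.measurable).inter
      (measurableSet_le continuous_norm.measurable measurable_const)
  have hSm : MeasurableSet S := measurableSet_le measurable_const continuous_norm.measurable
  -- the three pieces of the majorant
  set C₁ : ℝ := 16 * Φ * W * M with hC₁
  set C₂ : ℝ := 16 * Φ * W * ε with hC₂
  set C₃ : ℝ := Φ * ε * (‖ξ‖ ^ 2)⁻¹ with hC₃
  have hC₁0 : 0 ≤ C₁ := by positivity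
  have hC₂0 : 0 ≤ C₂ := by positivity
  have hC₃0 : 0 ≤ C₃ := by positivity
  set q : EuclideanSpace ℝ (Fin 3) → ℝ := A.indicator fun ζ => (‖ζ‖ ^ 2)⁻¹ with hq
  set w : EuclideanSpace ℝ (Fin 3) → ℝ := S.indicator fun η => ((1 + ‖η‖) ^ 4)⁻¹ with hw
  set b : EuclideanSpace ℝ (Fin 3) → ℝ := fun η =>
    C₁ * (ball (0 : EuclideanSpace ℝ (Fin 3)) R).indicator (fun _ => (1 : ℝ)) (ξ - η) + C₂ * q (ξ - η) + C₃ * w η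
    with hb
  have hq0 : ∀ ζ, 0 ≤ q ζ := fun ζ => by
    simp only [hq]; exact Set.indicator_nonneg (fun _ _ => by positivity) _
  have hw0 : ∀ η, 0 ≤ w η := fun η => by
    simp only [hw]; exact Set.indicator_nonneg (fun _ _ => by positivity) _
  have hind0 : ∀ ζ, 0 ≤ (ball (0 : EuclideanSpace ℝ (Fin 3)) R).indicator (fun _ => (1 : ℝ)) ζ :=
    fun ζ => Set.indicator_nonneg (fun _ _ => zero_le_one) _
  have hb0 : ∀ η, 0 ≤ b η := fun η => by
    simp only [hb]
    have := hq0 (ξ - η); have := hw0 η; have := hind0 (ξ - η)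
    positivity
  -- the key pointwise bound on the region `‖ξ‖ ≤ 2‖η‖`
  have hkey : ∀ η, ‖ξ‖ ≤ 2 * ‖η‖ → ‖v η‖ * ‖v (ξ - η)‖ ≤ b η := by
    intro η hη
    have hvη : ‖v η‖ ≤ Φ * ((1 + ‖η‖) ^ 4)⁻¹ := hΦ η
    have hvη' : ‖v η‖ ≤ 16 * Φ * W := by
      calc ‖v η‖ ≤ Φ * ((1 + ‖η‖) ^ 4)⁻¹ := hvη
        _ ≤ Φ * (16 * ((1 + ‖ξ‖) ^ 4)⁻¹) :=
            mul_le_mul_of_nonneg_left (inv_weight_le_sixteen_mul hη) hΦ0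
        _ = 16 * Φ * W := by rw [hW]; ring
    have hηS : η ∈ S := by simp only [hS, mem_setOf_eq]; linarith
    set ζ := ξ - η with hζ
    have hb1 : 0 ≤ C₁ * (ball (0 : EuclideanSpace ℝ (Fin 3)) R).indicator (fun _ => (1 : ℝ)) ζ :=
      mul_nonneg hC₁0 (hind0 ζ)
    have hb2 : 0 ≤ C₂ * q ζ := mul_nonneg hC₂0 (hq0 ζ)
    have hb3 : 0 ≤ C₃ * w η := mul_nonneg hC₃0 (hw0 η)
    rcases lt_or_ge ‖ζ‖ R with h1 | h1
    · -- `‖ζ‖ < R`: the low-frequency bound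
      have hvζ : ‖v ζ‖ ≤ M := hM ζ h1
      have hind : (ball (0 : EuclideanSpace ℝ (Fin 3)) R).indicator (fun _ => (1 : ℝ)) ζ = 1 := by
        rw [Set.indicator_of_mem (by simpa using h1)]
      calc ‖v η‖ * ‖v ζ‖ ≤ (16 * Φ * W) * M :=
            mul_le_mul hvη' hvζ (norm_nonneg _) (by positivity)
        _ = C₁ * (ball (0 : EuclideanSpace ℝ (Fin 3)) R).indicator (fun _ => (1 : ℝ)) ζ := by rw [hind, hC₁]; ring
        _ ≤ b η := by simp only [hb]; linarith
    · -- `R ≤ ‖ζ‖`: the tight envelope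
      have hζ0 : 0 < ‖ζ‖ := hR0.trans_le h1
      have hvζ : ‖v ζ‖ ≤ ε * (‖ζ‖ ^ 2)⁻¹ := by
        rw [← div_eq_mul_inv, le_div_iff₀ (by positivity), mul_comm]
        exact htight ζ h1
      rcases le_or_gt ‖ζ‖ ‖ξ‖ with h2 | h2
      · -- `R ≤ ‖ζ‖ ≤ ‖ξ‖`: the annulus
        have hζA : ζ ∈ A := ⟨h1, h2⟩
        have hqζ : q ζ = (‖ζ‖ ^ 2)⁻¹ := by simp only [hq, Set.indicator_of_mem hζA]
        calc ‖v η‖ * ‖v ζ‖ ≤ (16 * Φ * W) * (ε * (‖ζ‖ ^ 2)⁻¹) :=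
              mul_le_mul hvη' hvζ (norm_nonneg _) (by positivity)
          _ = C₂ * q ζ := by rw [hqζ, hC₂]; ring
          _ ≤ b η := by simp only [hb]; linarith
      · -- `‖ξ‖ < ‖ζ‖`: beyond, against the tail weight at `η`
        have hvζ' : ‖v ζ‖ ≤ ε * (‖ξ‖ ^ 2)⁻¹ := by
          refine hvζ.trans (mul_le_mul_of_nonneg_left ?_ hε)
          exact inv_anti₀ (by positivity) (pow_le_pow_left₀ hξ0.le h2.le 2)
        have hwη : w η = ((1 + ‖η‖) ^ 4)⁻¹ := by simp only [hw, Set.indicator_of_mem hηS]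
        calc ‖v η‖ * ‖v ζ‖ ≤ (Φ * ((1 + ‖η‖) ^ 4)⁻¹) * (ε * (‖ξ‖ ^ 2)⁻¹) :=
              mul_le_mul hvη hvζ' (norm_nonneg _) (by positivity)
          _ = C₃ * w η := by rw [hwη, hC₃]; ring
          _ ≤ b η := by simp only [hb]; linarith
  -- the symmetrised pointwise bound, everywhere
  have hpt : ∀ η, ‖v η j * v (ξ - η) k‖ ≤ b η + b (ξ - η) := by
    intro η
    rw [norm_mul]
    have hjk : ‖v η j‖ * ‖v (ξ - η) k‖ ≤ ‖v η‖ * ‖v (ξ - η)‖ :=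
      mul_le_mul (norm_le_pi_norm (v η) j) (norm_le_pi_norm (v (ξ - η)) k) (norm_nonneg _)
        (norm_nonneg _)
    refine hjk.trans ?_
    rcases norm_le_two_mul_or ξ η with h1 | h1
    · linarith [hkey η h1, hb0 (ξ - η)]
    · have h2 := hkey (ξ - η) h1
      rw [sub_sub_cancel, mul_comm] at h2
      linarith [hb0 η]
  -- integrability of the majorant
  have hballInt : Integrable fun ζ : EuclideanSpace ℝ (Fin 3) =>
      (ball (0 : EuclideanSpace ℝ (Fin 3)) R).indicator (fun _ => (1 : ℝ)) ζ :=
    (integrableOn_const (measure_ball_lt_top (x := (0 : EuclideanSpace ℝ (Fin 3))) (r := R)).ne).integrable_indicator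
      measurableSet_ball
  have hqInt : Integrable q := by
    have hAfin : volume A ≠ ⊤ := by
      refine (measure_mono (fun ζ hζ => ?_) |>.trans_lt
        (measure_closedBall_lt_top (x := (0 : EuclideanSpace ℝ (Fin 3))) (r := ‖ξ‖))).ne
      simpa [Metric.mem_closedBall, dist_zero_right] using hζ.2
    have hqm : AEStronglyMeasurable (fun ζ : EuclideanSpace ℝ (Fin 3) => (‖ζ‖ ^ 2)⁻¹) volume :=
      (continuous_norm.pow 2).measurable.inv.aestronglyMeasurable
    have hIO : IntegrableOn (fun ζ : EuclideanSpace ℝ (Fin 3) => (‖ζ‖ ^ 2)⁻¹) A volume := by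
      refine Measure.integrableOn_of_bounded hAfin hqm (M := (R ^ 2)⁻¹) ?_
      refine (ae_restrict_iff' hAm).2 (Eventually.of_forall fun ζ hζ => ?_)
      rw [Real.norm_of_nonneg (by positivity)]
      exact inv_anti₀ (by positivity) (pow_le_pow_left₀ hR0.le hζ.1 2)
    exact hIO.integrable_indicator hAm
  have hwInt : Integrable w :=
    ((integrable_inv_one_add_norm_pow (E := EuclideanSpace ℝ (Fin 3)) (K := 4)
      (by rw [finrank_euclideanSpace_fin_three]; norm_num)).indicator hSm)
  have hbInt : Integrable b := by
    simp only [hb]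
    exact (((hballInt.comp_sub_left ξ).const_mul C₁).add ((hqInt.comp_sub_left ξ).const_mul C₂)).add
      (hwInt.const_mul C₃)
  have hbInt' : Integrable fun η => b (ξ - η) := hbInt.comp_sub_left ξ
  -- the integral of the majorant
  have hIb : ∫ η, b η ≤ C₁ * vB + C₂ * (CE * ‖ξ‖) + C₃ * (CE * (‖ξ‖ / 2)⁻¹) := by
    have e : ∫ η, b η =
        C₁ * (∫ η, (ball (0 : EuclideanSpace ℝ (Fin 3)) R).indicator (fun _ => (1 : ℝ)) (ξ - η)) +
        C₂ * (∫ η, q (ξ - η)) + C₃ * ∫ η, w η := by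
      have h1 : Integrable fun η =>
          C₁ * (ball (0 : EuclideanSpace ℝ (Fin 3)) R).indicator (fun _ => (1 : ℝ)) (ξ - η) :=
        (hballInt.comp_sub_left ξ).const_mul C₁
      have h2 : Integrable fun η => C₂ * q (ξ - η) := (hqInt.comp_sub_left ξ).const_mul C₂
      have h3 : Integrable fun η => C₃ * w η := hwInt.const_mul C₃
      have h12 : Integrable fun η =>
          C₁ * (ball (0 : EuclideanSpace ℝ (Fin 3)) R).indicator (fun _ => (1 : ℝ)) (ξ - η) +
            C₂ * q (ξ - η) := h1.add h2
      simp only [hb]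
      rw [integral_add h12 h3, integral_add h1 h2, integral_const_mul, integral_const_mul,
        integral_const_mul]
    rw [e, integral_sub_left_eq_self (fun ζ => (ball (0 : EuclideanSpace ℝ (Fin 3)) R).indicator
        (fun _ => (1 : ℝ)) ζ) volume ξ, integral_sub_left_eq_self q volume ξ,
      integral_indicator_const (1 : ℝ) measurableSet_ball, smul_eq_mul, mul_one]
    have hI1 : volume.real (ball (0 : EuclideanSpace ℝ (Fin 3)) R) = vB := rfl
    have hI2 : ∫ ζ, q ζ ≤ CE * ‖ξ‖ := integral_annulus_inv_norm_sq_le hR0 hξ0.le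
    have hI3 : ∫ η, w η ≤ CE * (‖ξ‖ / 2)⁻¹ := integral_tail_weight_le (by positivity)
    rw [hI1]
    gcongr
  -- conclusion
  have hIsum : ∫ η, (b η + b (ξ - η)) = 2 * ∫ η, b η := by
    rw [integral_add hbInt hbInt', integral_sub_left_eq_self b volume ξ]; ring
  calc ‖fconv (v · j) (v · k) ξ‖ = ‖∫ η, v η j * v (ξ - η) k‖ := by rw [fconv_apply]
    _ ≤ ∫ η, ‖v η j * v (ξ - η) k‖ := norm_integral_le_integral_norm _
    _ ≤ ∫ η, (b η + b (ξ - η)) :=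
        integral_mono_of_nonneg (Eventually.of_forall fun η => norm_nonneg _) (hbInt.add hbInt')
          (Eventually.of_forall hpt)
    _ = 2 * ∫ η, b η := hIsum
    _ ≤ 2 * (C₁ * vB + C₂ * (CE * ‖ξ‖) + C₃ * (CE * (‖ξ‖ / 2)⁻¹)) := by linarith [hIb]
    _ = Φ * W * (32 * M * vB + 32 * ε * CE * ‖ξ‖) + 4 * Φ * ε * CE * (‖ξ‖ ^ 3)⁻¹ := by
        rw [hC₁, hC₂, hC₃]
        field_simp
        ring


/-! ### The absorption inequality (pure algebra) -/

/-- **Absorption.** With `x = ‖ξ‖ ≥ R₁ ≥ 1`, the order-`4` weight of the Duhamel term built from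
the convolution bound of `norm_fconv_le_of_tight` (symbol `36π x`, heat integral `(c x²)⁻¹`) is at
most `Φ/2` as soon as `13824 π ε · C_E ≤ c` and `4608 π M |B_R| ≤ c R₁`
(three terms: `≤ Φ/4`, `≤ Φ/12`, `≤ Φ/6`). -/
theorem absorb_le_half {c x R₁ Φ M ε vB CE : ℝ} (hc : 0 < c) (hR₁ : 1 ≤ R₁) (hx : R₁ ≤ x)
    (hΦ : 0 ≤ Φ) (hε : 0 ≤ ε) (hCE : 0 ≤ CE)
    (h1 : 13824 * π * ε * CE ≤ c) (h2 : 4608 * π * M * vB ≤ c * R₁) :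
    (1 + x) ^ 4 * ((c * x ^ 2)⁻¹ * (36 * π * x *
      (Φ * ((1 + x) ^ 4)⁻¹ * (32 * M * vB + 32 * ε * CE * x) + 4 * Φ * ε * CE * (x ^ 3)⁻¹))) ≤
      Φ / 2 := by
  have hx1 : 1 ≤ x := hR₁.trans hx
  have hx0 : 0 < x := by linarith
  have hW : 0 < (1 + x) ^ 4 := by positivity
  have e : (1 + x) ^ 4 * ((c * x ^ 2)⁻¹ * (36 * π * x *
      (Φ * ((1 + x) ^ 4)⁻¹ * (32 * M * vB + 32 * ε * CE * x) + 4 * Φ * ε * CE * (x ^ 3)⁻¹))) =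
      1152 * π * Φ * M * vB / (c * x) + 1152 * π * Φ * ε * CE / c +
        144 * π * Φ * ε * CE * (1 + x) ^ 4 / (c * x ^ 4) := by
    field_simp
    ring
  rw [e]
  have t1 : 1152 * π * Φ * M * vB / (c * x) ≤ Φ / 4 := by
    rw [div_le_div_iff₀ (by positivity) (by norm_num : (0 : ℝ) < 4)]
    calc 1152 * π * Φ * M * vB * 4 = Φ * (4608 * π * M * vB) := by ring
      _ ≤ Φ * (c * R₁) := by gcongr
      _ ≤ Φ * (c * x) := by gcongr
  have t2 : 1152 * π * Φ * ε * CE / c ≤ Φ / 12 := by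
    rw [div_le_div_iff₀ hc (by norm_num : (0 : ℝ) < 12)]
    calc 1152 * π * Φ * ε * CE * 12 = Φ * (13824 * π * ε * CE) := by ring
      _ ≤ Φ * c := by gcongr
  have t3 : 144 * π * Φ * ε * CE * (1 + x) ^ 4 / (c * x ^ 4) ≤ Φ / 6 := by
    rw [div_le_div_iff₀ (by positivity) (by norm_num : (0 : ℝ) < 6)]
    have h16 : (1 + x) ^ 4 ≤ 16 * x ^ 4 := by
      calc (1 + x) ^ 4 ≤ (2 * x) ^ 4 := pow_le_pow_left₀ (by positivity) (by linarith) 4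
        _ = 16 * x ^ 4 := by ring
    calc 144 * π * Φ * ε * CE * (1 + x) ^ 4 * 6 ≤ 144 * π * Φ * ε * CE * (16 * x ^ 4) * 6 := by
          gcongr
      _ = Φ * (13824 * π * ε * CE) * x ^ 4 := by ring
      _ ≤ Φ * c * x ^ 4 := by gcongr
      _ = Φ * (c * x ^ 4) := by ring
  linarith

end Summit.NavierStokesRegularity.NavierStokesRegularity.Theorems.TightEnvelope

end
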